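import Summits.NavierStokesRegularity.NavierStokesRegularity.Theses.SymmetryModuliCount
import Summits.NavierStokesRegularity.NavierStokesRegularity.Theorems.MustSqueeze.Negative.ConstantsKNSSMild
import Summits.NavierStokesRegularity.NavierStokesRegularity.Theorems.ForcedSymmetry.Negative.Witness
import Summits.NavierStokesRegularity.NavierStokesRegularity.Theorems.SqueezeCycleExtremalBiaxialitySubcriticalSmallConstant

/-!
# Crux `ForcedSymmetry` (stmt-NavierStokesRegularity-4052, route SymmetryModuliCount), negative side:
# read-back, degenerate instances, and the crux without the Oseen identity is false

Negative-side (cdisprove, D-0016) support lemmas extracted from the crux work file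
`Cruxes/ForcedSymmetry/Disproof.lean` v1 so that ideators / planners / provers can IMPORT them:

* `forcedSymmetry_iff : ForcedSymmetry ↔ ∀ C u, InClassA C u → HasSimSymmetry u` (`Iff.rfl`), where
  `InClassA C u := H1 u ∧ H2 u ∧ H3 u ∧ H4 C u` are VERBATIM the clauses of the sister crux `MustSqueeze`
  (`Theorems/MustSqueeze/Negative/WithoutOseen.lean`; its written-out Oseen integrand is
  `oseenKernel (t-τ) (x-y) (u τ y) (u τ y)` by `rfl`) and `simGen u a σ A` is the crux's generator
  `L_ξ u = ∇u·(a + σx + Ax) + σu + 2σt ∂_t u − Au` of `ξ = (a, σ, A) ∈ sim(3)`;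
* degenerate instances HOLD (no junk refutation): `forcedSymmetry_holds_of_nonpos` (`C ≤ 0`),
  `inClassA_zero` (the zero field is a member for `C ≥ 0` and is symmetric),
  `const_inClass_without_H4_and_symmetric` (constants satisfy H1–H3, fail only H4, and ARE symmetric —
  so deleting the Type-I clause H4 is not cheaply refutable either);
* `forcedSymmetry_false_without_H3` — with ONLY the KNSS/Oseen mild clause H3 deleted the statement is
  FALSE: the explicit field `w t x = e^{t/2} e^{−‖x‖²} (rot x + x₀ rot0 x)` of `Negative/Witness.lean` is
  smooth (H1), divergence free (H2), obeys the Type-I rate with `C = 2` (H4) and has NO nonzero infinitesimal similarity symmetry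
  (`w_rigid`: `L_ξ w ≡ 0 ⇒ ξ = 0`, by the non-self-similar clock `e^{t/2}` killing `σ` and four point
  evaluations of the polynomial defect killing `(a, A)`).  Hence the typed side clauses hide no junk, and
  any proof of the crux (any "dimension / moduli count") must use the Navier–Stokes (Oseen) identity.

No statement of the route is changed; nothing here closes the item (`--supports`).
-/

noncomputable section

namespace Summit.NavierStokesRegularity.NavierStokesRegularity.Theorems.ForcedSymmetry.Negative

open MeasureTheory Set Filter Topology
open Literature.Analysis.FluidPDE Literature.Analysis.UnboundedOperators
open Summit.NavierStokesRegularity.NavierStokesRegularity.Theses.SymmetryModuliCount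
open Summit.NavierStokesRegularity.NavierStokesRegularity.Theorems.MustSqueeze.Negative

/-! ## §1 Read-back over named clauses -/

/-- Membership in the Type-I KNSS-mild ancient class `A_C`: H1 (smooth on `t<0`) ∧ H2 (div-free) ∧
H3 (Oseen mild identity) ∧ H4 (Type-I rate `‖u‖ ≤ C/√(−t)`), the clauses of `MustSqueeze.Negative`. -/
def InClassA (C : ℝ) (u : ℝ → EuclideanSpace ℝ (Fin 3) → EuclideanSpace ℝ (Fin 3)) : Prop :=
  H1 u ∧ H2 u ∧ H3 u ∧ H4 C u

/-- The infinitesimal generator `L_ξ u` of `ξ = (a, σ, A) ∈ sim(3)` acting on `u` (verbatim the crux). -/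
def simGen (u : ℝ → EuclideanSpace ℝ (Fin 3) → EuclideanSpace ℝ (Fin 3)) (a : EuclideanSpace ℝ (Fin 3)) (σ : ℝ)
    (A : EuclideanSpace ℝ (Fin 3) →L[ℝ] EuclideanSpace ℝ (Fin 3)) (t : ℝ) (x : EuclideanSpace ℝ (Fin 3)) :
    EuclideanSpace ℝ (Fin 3) :=
  fderiv ℝ (u t) x (a + σ • x + A x) + σ • u t x + (2 * σ * t) • timeDeriv u t x - A (u t x)

/-- The conclusion of the crux: some NONZERO `ξ = (a, σ, A)`, `A` skew, annihilates `u` on `t < 0`. -/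
def HasSimSymmetry (u : ℝ → EuclideanSpace ℝ (Fin 3) → EuclideanSpace ℝ (Fin 3)) : Prop :=
  ∃ (a : EuclideanSpace ℝ (Fin 3)) (σ : ℝ) (A : EuclideanSpace ℝ (Fin 3) →L[ℝ] EuclideanSpace ℝ (Fin 3)),
    (∀ x, inner ℝ (A x) x = 0) ∧ ¬ (a = 0 ∧ σ = 0 ∧ A = 0) ∧ ∀ t < 0, ∀ x, simGen u a σ A t x = 0

/-- **Read-back.** The crux is definitionally `∀ C u, u ∈ A_C → u has a nonzero similarity symmetry`. -/
theorem forcedSymmetry_iff :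
    ForcedSymmetry ↔ ∀ (C : ℝ) (u : ℝ → EuclideanSpace ℝ (Fin 3) → EuclideanSpace ℝ (Fin 3)),
      InClassA C u → HasSimSymmetry u :=
  Iff.rfl

/-! ## §2 Degenerate instances hold -/

/-- A field vanishing identically on `t < 0` has EVERY similarity symmetry (here: translation by `e₀`). -/
theorem hasSimSymmetry_of_vanishes {u : ℝ → EuclideanSpace ℝ (Fin 3) → EuclideanSpace ℝ (Fin 3)}
    (h : ∀ t < 0, ∀ x, u t x = 0) : HasSimSymmetry u := by
  refine ⟨e0, 0, 0, fun x => by simp, fun hh => ?_, fun t ht x => ?_⟩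
  · have : ‖(e0 : EuclideanSpace ℝ (Fin 3))‖ = 1 := by simp [e0]
    rw [hh.1, norm_zero] at this
    exact zero_ne_one this
  · have hut : u t = fun _ => 0 := funext (h t ht)
    simp [simGen, hut]

/-- `C ≤ 0`: H4 alone forces `u ≡ 0` on `t<0`, so the crux holds there for trivial reasons
(intended under `∀ C`; not a defect). -/
theorem forcedSymmetry_holds_of_nonpos (C : ℝ) (hC : C ≤ 0)
    (u : ℝ → EuclideanSpace ℝ (Fin 3) → EuclideanSpace ℝ (Fin 3)) (hu : InClassA C u) : HasSimSymmetry u :=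
  hasSimSymmetry_of_vanishes (vanishes_of_h4_nonpos hC hu.2.2.2)

/-- The zero field lies in `A_C` for every `C ≥ 0` (hypotheses satisfiable) and is symmetric. -/
theorem inClassA_zero {C : ℝ} (hC : 0 ≤ C) :
    InClassA C (fun _ _ => 0) ∧ HasSimSymmetry (fun _ _ => (0 : EuclideanSpace ℝ (Fin 3))) :=
  ⟨⟨(inClass_zero hC).1.1, (inClass_zero hC).1.2.1, (inClass_zero hC).1.2.2.1, (inClass_zero hC).1.2.2.2.1⟩,
    hasSimSymmetry_of_vanishes fun _ _ _ => rfl⟩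

/-- Constants satisfy H1, H2, H3 (KNSS-mild: `isKNSSMild_const`) — they fail only H4 — and they ARE
symmetric (translation- and rotation-invariant).  Hence the crux with H4 deleted is NOT refuted by the
only new members one can write down; a refutation without H4 would again need a non-constant bounded
KNSS-mild ancient solution (KNSS2009 Liouville conjecture). -/
theorem const_inClass_without_H4_and_symmetric (c : EuclideanSpace ℝ (Fin 3)) :
    (H1 (fun _ _ => c) ∧ H2 (fun _ _ => c) ∧ H3 (fun _ _ => c)) ∧ HasSimSymmetry (fun _ _ => c) := by
  refine ⟨⟨(h1_h2_h6_const c).1, (h1_h2_h6_const c).2.1, isKNSSMild_const c⟩, ?_⟩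
  refine ⟨e0, 0, 0, fun x => by simp, fun hh => ?_, fun t _ x => ?_⟩
  · have : ‖(e0 : EuclideanSpace ℝ (Fin 3))‖ = 1 := by simp [e0]
    rw [hh.1, norm_zero] at this
    exact zero_ne_one this
  · simp [simGen]

/-! ## §3 H3 (the Oseen/NS identity) is load-bearing: the witness `w` of `Negative/Witness.lean` -/

/-- H1: `w` is smooth (globally). -/
theorem w_h1 : H1 w := by
  have hs : ContDiff ℝ (⊤ : ℕ∞) (fun p : ℝ × EuclideanSpace ℝ (Fin 3) => Real.exp (p.1 / 2)) :=
    Real.contDiff_exp.comp (contDiff_fst.div_const 2)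
  have hV : ContDiff ℝ (⊤ : ℕ∞) (fun p : ℝ × EuclideanSpace ℝ (Fin 3) => V p.2) := contDiff_V.comp contDiff_snd
  exact (hs.smul hV).contDiffOn

/-- H2: `w` is divergence free:
`div = e^{t/2} g (tr DP − 2⟪x, P x⟫) = e^{t/2} g (0 − 0)`. -/
theorem w_h2 : H2 w := by
  intro t _ x
  have hb := divergence_eq_sum_inner_fderiv (EuclideanSpace.basisFun (Fin 3) ℝ) (w t) x
  rw [hb, fderiv_w, Fin.sum_univ_three]
  simp only [EuclideanSpace.basisFun_apply, FunLike.coe_smul, Pi.smul_apply, real_inner_smul_right,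
    inner_single_one_left, inner_single_one_right, DV_apply, PiLp.add_apply, PiLp.smul_apply, smul_eq_mul, DP_c0, DP_c1, DP_c2,
    P_c0, P_c1, P_c2, PiLp.single_apply]
  simp
  ring

/-- H4: the Type-I rate with constant `2`: `‖w‖ ≤ 2 e^{t/2} ≤ 2/√(−t)`. -/
theorem w_h4 : H4 2 w := by
  intro t ht x
  have hs : 0 < Real.sqrt (-t) := Real.sqrt_pos.2 (by linarith)
  rw [le_div_iff₀ hs, w, norm_smul, Real.norm_eq_abs, abs_of_pos (Real.exp_pos _)]
  have h2 : Real.sqrt (-t) * Real.exp (t / 2) ≤ 1 := by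
    have := sqrt_mul_exp_neg_half_le_one (by linarith : 0 ≤ -t)
    simpa [neg_neg] using this
  calc Real.exp (t / 2) * ‖V x‖ * Real.sqrt (-t) = (Real.sqrt (-t) * Real.exp (t / 2)) * ‖V x‖ := by ring
    _ ≤ 1 * 2 := mul_le_mul h2 (norm_V_le x) (norm_nonneg _) zero_le_one
    _ = 2 := by norm_num


/-! ### The witness has NO nonzero infinitesimal similarity symmetry -/

/-- The `t`-independent part of `e^{-t/2} L_ξ w`. -/
def core (a : EuclideanSpace ℝ (Fin 3)) (σ : ℝ) (A : EuclideanSpace ℝ (Fin 3) →L[ℝ] EuclideanSpace ℝ (Fin 3))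
    (x : EuclideanSpace ℝ (Fin 3)) : EuclideanSpace ℝ (Fin 3) :=
  DV x (a + σ • x + A x) + σ • V x - A (V x)

/-- `L_ξ w (t,x) = e^{t/2} (core(x) + σ t V x)`: the non-self-similar clock `e^{t/2}` leaves a term
LINEAR in `t`, which is what kills the scaling component `σ`. -/
theorem simGen_w (a : EuclideanSpace ℝ (Fin 3)) (σ : ℝ) (A : EuclideanSpace ℝ (Fin 3) →L[ℝ] EuclideanSpace ℝ (Fin 3))
    (t : ℝ) (x : EuclideanSpace ℝ (Fin 3)) :
    simGen w a σ A t x = Real.exp (t / 2) • (core a σ A x + (σ * t) • V x) := by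
  unfold simGen
  rw [fderiv_w, timeDeriv_w]
  simp only [w, map_smul, core, FunLike.coe_smul, Pi.smul_apply]
  module

/-- The reduced (Gaussian-free, polynomial) symmetry defect at `σ = 0`:
`DV x (a + A x) − A (V x) = g(x) · R(x)`. -/
def R (a : EuclideanSpace ℝ (Fin 3)) (A : EuclideanSpace ℝ (Fin 3) →L[ℝ] EuclideanSpace ℝ (Fin 3))
    (x : EuclideanSpace ℝ (Fin 3)) : EuclideanSpace ℝ (Fin 3) :=
  DP x (a + A x) + (-2 * inner ℝ x (a + A x)) • P x - A (P x)

/-- At `σ = 0` the defect factors through the Gaussian: `core a 0 A x = g(x) • R a A x`. -/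
theorem core_zero_sigma (a : EuclideanSpace ℝ (Fin 3)) (A : EuclideanSpace ℝ (Fin 3) →L[ℝ] EuclideanSpace ℝ (Fin 3))
    (x : EuclideanSpace ℝ (Fin 3)) : core a 0 A x = gauss x • R a A x := by
  simp only [core, R, zero_smul, add_zero, DV_apply, V, map_smul]
  module

section Rigid

variable {a : EuclideanSpace ℝ (Fin 3)} {σ : ℝ} {A : EuclideanSpace ℝ (Fin 3) →L[ℝ] EuclideanSpace ℝ (Fin 3)}

/-- Step 1: the scaling component vanishes (slices `t = -1, -2` at `x = e₀`, where `V e₀ = e^{-1} e₁ ≠ 0`). -/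
theorem sigma_eq_zero (h : ∀ t < 0, ∀ x, simGen w a σ A t x = 0) : σ = 0 := by
  have h1 := h (-1) (by norm_num) e0
  have h2 := h (-2) (by norm_num) e0
  rw [simGen_w] at h1 h2
  have h1' := (smul_eq_zero.1 h1).resolve_left (Real.exp_pos _).ne'
  have h2' := (smul_eq_zero.1 h2).resolve_left (Real.exp_pos _).ne'
  have key : σ • V e0 = (core a σ A e0 + (σ * (-1 : ℝ)) • V e0) - (core a σ A e0 + (σ * (-2 : ℝ)) • V e0) := by
    module
  rw [h1', h2', sub_zero, V_e0, smul_smul] at key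
  have h3 := (smul_eq_zero.1 key).resolve_right e1_ne_zero
  exact (mul_eq_zero.1 h3).resolve_right (gauss_pos e0).ne'

/-- Step 2: with `σ = 0`, the reduced defect vanishes everywhere. -/
theorem R_eq_zero (h : ∀ t < 0, ∀ x, simGen w a σ A t x = 0) (x : EuclideanSpace ℝ (Fin 3)) : R a A x = 0 := by
  have hσ := sigma_eq_zero h
  have h1 := h (-1) (by norm_num) x
  rw [simGen_w, hσ, zero_mul, zero_smul, add_zero, core_zero_sigma] at h1
  have h1' := (smul_eq_zero.1 h1).resolve_left (Real.exp_pos _).ne'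
  exact (smul_eq_zero.1 h1').resolve_left (gauss_pos x).ne'

/-- Polarisation of skewness. -/
theorem skew_polar (hA : ∀ x, inner ℝ (A x) x = 0) (x y : EuclideanSpace ℝ (Fin 3)) :
    inner ℝ (A x) y = - inner ℝ (A y) x := by
  have h := hA (x + y)
  rw [map_add, inner_add_left, inner_add_right, inner_add_right, hA x, hA y] at h
  linarith

/-- Skewness: diagonal entries vanish, `(A e_i)_i = 0`. -/
theorem skew_diag (hA : ∀ x, inner ℝ (A x) x = 0) (i : Fin 3) : A (EuclideanSpace.single i 1) i = 0 := by
  have := hA (EuclideanSpace.single i 1); rwa [inner_single_one_right] at this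

/-- Skewness: `(A e_j)_i = −(A e_i)_j`. -/
theorem skew_off (hA : ∀ x, inner ℝ (A x) x = 0) (i j : Fin 3) :
    A (EuclideanSpace.single j 1) i = - A (EuclideanSpace.single i 1) j := by
  have := skew_polar hA (EuclideanSpace.single j 1) (EuclideanSpace.single i 1)
  rwa [inner_single_one_right, inner_single_one_right] at this

/-- Step 3: all twelve coordinates of `(a, A e₀, A e₁, A e₂)` vanish. -/
theorem coords_eq_zero (hA : ∀ x, inner ℝ (A x) x = 0) (h : ∀ t < 0, ∀ x, simGen w a σ A t x = 0) :
    (a 0 = 0 ∧ a 1 = 0 ∧ a 2 = 0) ∧ (A e0 0 = 0 ∧ A e0 1 = 0 ∧ A e0 2 = 0) ∧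
      (A e1 0 = 0 ∧ A e1 1 = 0 ∧ A e1 2 = 0) ∧ (A e2 0 = 0 ∧ A e2 1 = 0 ∧ A e2 2 = 0) := by
  -- skewness
  have d0 : A e0 0 = 0 := skew_diag hA 0
  have d1 : A e1 1 = 0 := skew_diag hA 1
  have d2 : A e2 2 = 0 := skew_diag hA 2
  have o01 : A e1 0 = - A e0 1 := skew_off hA 0 1
  have o02 : A e2 0 = - A e0 2 := skew_off hA 0 2
  have o12 : A e2 1 = - A e1 2 := skew_off hA 1 2
  -- the reduced defect at 0, e₂, -e₂, e₀
  have r0 := R_eq_zero h 0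
  have r2 := R_eq_zero h e2
  have r2' := R_eq_zero h (-e2)
  have r1 := R_eq_zero h e0
  simp only [R, map_zero, add_zero, P_zero, smul_zero, sub_zero, P_e2, P_neg_e2, map_neg, P_e0] at r0 r2 r2' r1
  have c00 := congrArg (fun v : EuclideanSpace ℝ (Fin 3) => v 0) r0
  have c01 := congrArg (fun v : EuclideanSpace ℝ (Fin 3) => v 1) r0
  have c20 := congrArg (fun v : EuclideanSpace ℝ (Fin 3) => v 0) r2
  have c2'1 := congrArg (fun v : EuclideanSpace ℝ (Fin 3) => v 1) r2'
  have c11 := congrArg (fun v : EuclideanSpace ℝ (Fin 3) => v 1) r1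
  have c12 := congrArg (fun v : EuclideanSpace ℝ (Fin 3) => v 2) r1
  simp only [DP_c0, DP_c1, DP_c2, PiLp.add_apply, PiLp.sub_apply, PiLp.neg_apply, PiLp.smul_apply,
    PiLp.zero_apply, smul_eq_mul, e0_c0, e0_c1, e0_c2, e1_c1, e1_c2, e2_c0, e2_c2,
    inner_e0_left] at c00 c01 c20 c2'1 c11 c12
  have ha1 : a 1 = 0 := by linarith
  have ha0 : a 0 = 0 := by nlinarith
  have h21 : A e2 1 = 0 := by linarith
  have h20 : A e2 0 = 0 := by nlinarith
  have h02 : A e0 2 = 0 := by linarith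
  have ha2 : a 2 = 0 := by nlinarith
  have h12 : A e1 2 = 0 := by linarith
  have h01 : A e0 1 = 0 := by nlinarith
  refine ⟨⟨ha0, ha1, ha2⟩, ⟨d0, h01, h02⟩, ⟨by linarith, d1, h12⟩, ⟨h20, h21, d2⟩⟩

/-- **Rigidity of the witness**: `L_ξ w ≡ 0` on `t < 0` with `A` skew forces `ξ = (a, σ, A) = 0`. -/
theorem w_rigid (hA : ∀ x, inner ℝ (A x) x = 0) (h : ∀ t < 0, ∀ x, simGen w a σ A t x = 0) :
    a = 0 ∧ σ = 0 ∧ A = 0 := by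
  obtain ⟨⟨ha0, ha1, ha2⟩, ⟨h00, h01, h02⟩, ⟨h10, h11, h12⟩, ⟨h20, h21, h22⟩⟩ := coords_eq_zero hA h
  refine ⟨?_, sigma_eq_zero h, ?_⟩
  · ext i; fin_cases i <;> simp [ha0, ha1, ha2]
  · have hA0 : A e0 = 0 := by ext i; fin_cases i <;> simp [h00, h01, h02]
    have hA1 : A e1 = 0 := by ext i; fin_cases i <;> simp [h10, h11, h12]
    have hA2 : A e2 = 0 := by ext i; fin_cases i <;> simp [h20, h21, h22]
    refine ContinuousLinearMap.coe_inj.1 ((EuclideanSpace.basisFun (Fin 3) ℝ).toBasis.ext fun i => ?_)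
    fin_cases i
    · simpa [e0] using hA0
    · simpa [e1] using hA1
    · simpa [e2] using hA2

end Rigid

/-! ### Conclusion: H3 is load-bearing -/

/-- The crux with ONLY the KNSS/Oseen mild clause H3 deleted (the "kinematic" Type-I class). -/
def ForcedSymmetryWithoutH3 : Prop :=
  ∀ (C : ℝ) (u : ℝ → EuclideanSpace ℝ (Fin 3) → EuclideanSpace ℝ (Fin 3)), H1 u ∧ H2 u ∧ H4 C u → HasSimSymmetry u

/-- **Any proof of `ForcedSymmetry` must use the Oseen identity H3.**  With H3 deleted the statement
is FALSE: `w t x = e^{t/2} e^{−‖x‖²}(rot x + x₀ rot0 x)` is smooth, divergence free, obeys the Type-I rate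
with `C = 2`, and has NO nonzero infinitesimal similarity symmetry (`w_rigid`).  In particular a
dimension/symmetry count cannot come from the typed side clauses: smoothness + incompressibility + the
Type-I ceiling carry symmetry-free fields (indeed an infinite-dimensional family of them). -/
theorem forcedSymmetry_false_without_H3 : ¬ ForcedSymmetryWithoutH3 := by
  intro h
  obtain ⟨a, σ, A, hA, hne, hL⟩ := h 2 w ⟨w_h1, w_h2, w_h4⟩
  exact hne (w_rigid hA hL)


/-- The crux transplanted to the GENERAL Type-I drift class (smooth, divergence free, `‖u‖ ≤ C/√(−t)`,
`‖∇u‖ ≤ C/(−t)`; NOT necessarily Navier–Stokes) — the hypothesis class of `FiniteTangentModuliMild`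
(stmt-14049; formerly `FiniteTangentModuli`, stmt-4055, refuted p73226). -/
def ForcedSymmetryOnDriftClass : Prop :=
  ∀ (C : ℝ) (u : ℝ → EuclideanSpace ℝ (Fin 3) → EuclideanSpace ℝ (Fin 3)), H1 u → H2 u → H4 C u →
    (∀ t < 0, ∀ x, ‖fderiv ℝ (u t) x‖ ≤ C / (-t)) → HasSimSymmetry u

/-- **Symmetry is not forced on Type-I drifts.**  Even with the scale-invariant gradient bound added,
the kinematic class carries the symmetry-free witness `w` (constant `C = 7`).  So no argument that sees
`u` only as a Type-I drift (the setting of `FiniteTangentModuliMild` / the linearised engine for general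
drifts) can yield `ForcedSymmetry`; the nonlinear Oseen identity for `u` itself is indispensable. -/
theorem not_forcedSymmetryOnDriftClass : ¬ ForcedSymmetryOnDriftClass := by
  intro h
  have h4 : H4 7 w := fun t ht x => (w_h4 t ht x).trans
    (div_le_div_of_nonneg_right (by norm_num) (Real.sqrt_nonneg _))
  obtain ⟨a, σ, A, hA, hne, hL⟩ := h 7 w w_h1 w_h2 h4 w_grad
  exact hne (w_rigid hA hL)

/-! ## §4 Boundary: the perturbative regime `C ≤ ε` is empty (tree theorem, reused) -/

/-- The typed class `A_C` of the route IS the tree's `IsTypeIAncientMild C` (KNSS-mild Type-I ancient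
fields, `Literature/Analysis/FluidPDE/TypeIAncientMild.lean`), definitionally up to `1 * (t - τ)`. -/
theorem inClassA_iff_isTypeIAncientMild {C : ℝ} {u : ℝ → EuclideanSpace ℝ (Fin 3) → EuclideanSpace ℝ (Fin 3)} :
    InClassA C u ↔ IsTypeIAncientMild C u := by
  rw [isTypeIAncientMild_iff]
  rfl

/-- **Boundary lemma: the perturbative regime is empty.**  There is an absolute `ε > 0` such that for
`C ≤ ε` the class `A_C` is `{0}` (the tree's `Theorems.exists_typeIAncientMild_eq_zero_of_small`: the
Type-I bound halves itself through the Oseen identity while `32 C_B C ≤ 1`; Leray 1934 (3.9), KNSS2009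
§4 p. 8), so `ForcedSymmetry` — indeed `X` and every crux of the route — holds there for trivial
reasons.  Any counterexample to the crux has Type-I constant `C > ε`: the content of the crux sits
entirely at LARGE `C`, where no perturbative/contraction argument is available. -/
theorem exists_eps_inClassA_vanishes :
    ∃ ε : ℝ, 0 < ε ∧ ∀ (C : ℝ) (u : ℝ → EuclideanSpace ℝ (Fin 3) → EuclideanSpace ℝ (Fin 3)),
      C ≤ ε → InClassA C u → (∀ t < 0, ∀ x, u t x = 0) := by
  obtain ⟨ε, hε, h⟩ :=
    Summit.NavierStokesRegularity.NavierStokesRegularity.Theorems.exists_typeIAncientMild_eq_zero_of_small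
  exact ⟨ε, hε, fun C u hC hu => h C u (inClassA_iff_isTypeIAncientMild.1 hu) hC⟩

/-- Hence the crux holds for `C ≤ ε` (every member is `0`, which is symmetric). -/
theorem exists_eps_forcedSymmetry_small :
    ∃ ε : ℝ, 0 < ε ∧ ∀ (C : ℝ) (u : ℝ → EuclideanSpace ℝ (Fin 3) → EuclideanSpace ℝ (Fin 3)),
      C ≤ ε → InClassA C u → HasSimSymmetry u := by
  obtain ⟨ε, hε, h⟩ := exists_eps_inClassA_vanishes
  exact ⟨ε, hε, fun C u hC hu => hasSimSymmetry_of_vanishes (h C u hC hu)⟩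

end Summit.NavierStokesRegularity.NavierStokesRegularity.Theorems.ForcedSymmetry.Negative
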